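import Literature.AlgebraicGeometry.Motives.EllipticQuadricConstantFieldExtensions
import HarnessLib

/-!
# The hyperbolic quadric `ℋ_{2l+3}` over ALL constant field extensions `𝔽_{q^m}` and the comparison with `ℰ_{2l+3}`:
# `Z(ℋ ⊗ 𝔽_{q^m}, T) = 1/(∏_{i≤2l+2}(1 − q^{mi}T) · (1 − q^{m(l+1)}T))`, the middle pole is DOUBLE for every `m`;
# `#ℰ(𝔽_{q^m}) = #ℋ(𝔽_{q^m}) ⟺ Z(ℰ ⊗ 𝔽_{q^m}) = Z(ℋ ⊗ 𝔽_{q^m}) ⟺ m even`; in cohomology, polynomial point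
# counts make `H^{2r}(X)(r)` generalized-unipotent under `φ_r(Fᵐ)` for EVERY `m`

Topic `Literature/AlgebraicGeometry/Motives`; THEOREMS ONLY (no definition, no instance, no named fact; D-0026).
Sequel to g51-#8 (`Motives/SplitQuadricPointCount`: `#ℋ(𝔽_{q^m}) = Σ_{i≤2l+2} q^{mi} + q^{m(l+1)}`, `Z(ℋ, T)`, double
middle pole over `𝔽_q`), g52-#3 (`Motives/QuadricsFiniteFieldCohomology`) and g52-#6
(`Motives/EllipticQuadricConstantFieldExtensions`: the elliptic quadric over `𝔽_{q^m}`, parity law).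

* §0 (pure linear algebra, Malle–Testerman §2.1): `maxGenEigenspace_pow_eq_top_of_eq_top` (if `V = V_{(f),1}` then
  `V = V_{(fᵐ),1}`: `fᵐ − 1 = (1 + f + ⋯ + f^{m−1})(f − 1)` with commuting factors), `ker_pow_sub_one_eq_top_of_eq_top`.
* §1 (E-free): **`zetaSeriesPow_splitQuadric_mul_prod`** (`Z(ℋ ⊗ 𝔽_{q^m}, T)·∏_{i≤2l+2}(1 − (q^m)ⁱT)·(1 − (q^m)^{l+1}T) = 1`
  for every `m ≥ 1`), **`hasPoleOfOrderAt_zetaSeriesPow_splitQuadric`** (order EXACTLY `1 + [r = l+1]` at `(q^m)^{−r}`),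
  `…_middle` (`2`), `…_of_ne` (`1`); the comparison with the elliptic quadric in the same `ℙ^{2l+3}`:
  `pointCount_ellipticQuadric_eq_splitQuadric_of_even`, **`pointCount_ellipticQuadric_add_eq_splitQuadric_of_odd`**
  (`#ℰ(𝔽_{q^m}) + 2q^{m(l+1)} = #ℋ(𝔽_{q^m})`, `m` odd), `pointCount_ellipticQuadric_lt_splitQuadric_of_odd`,
  **`pointCount_ellipticQuadric_eq_splitQuadric_iff`** (`⟺ m` even), `zetaSeriesPow_ellipticQuadric_eq_splitQuadric_of_even`
  (all even `m`; the tree had `m = 2`), **`zetaSeriesPow_ellipticQuadric_ne_splitQuadric_of_odd`** (the middle pole orders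
  `1 ≠ 2` differ), **`zetaSeriesPow_ellipticQuadric_eq_splitQuadric_iff`** (`Z(ℰ ⊗ 𝔽_{q^m}) = Z(ℋ ⊗ 𝔽_{q^m}) ⟺ m` even).
* §2 (`E` with the trace formula, `χ(φ) = q`, RH; ANY smooth projective `X` with polynomial point counts
  `#X(𝔽_{q^m}) = Σ c_r q^{rm}`): **`GaloisWeilCohomology.maxGenEigenspace_ρTwist_pow_eq_top_of_pointCount_eq_sum`**
  (`H^{2r}(X)(r) = H^{2r}(X)(r)_{(φ_r(Fᵐ)),1}` for EVERY `m`), `finrank_maxGenEigenspace_ρTwist_pow_of_pointCount_eq_sum`,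
  **`hasPoleOfOrderAt_zetaSeriesPow_of_pointCount_eq_sum`** (`ord_{T=(q^m)^{−r}} Z(X ⊗ 𝔽_{q^m}, T) = b_{2r}(X)` for every
  `m ≥ 1`, `r ≤ d`), `ker_ρTwist_pow_sub_one_eq_top_of_pointCount_eq_sum` (`φ_r` semisimple at `1` ⟹ `φ_r(Fᵐ) = 1`).
* §3 (`E`, the hyperbolic quadric): `maxGenEigenspace_ρTwist_pow_splitQuadric_eq_top`,
  **`finrank_maxGenEigenspace_ρTwist_pow_splitQuadric_middle`** (`= 2` for every `m`), `…_of_ne` (`= 1`),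
  `ker_ρTwist_pow_sub_one_splitQuadric_eq_top_of_semisimple`, and the E-level comparison
  **`finrank_maxGenEigenspace_ρTwist_pow_middle_ellipticQuadric_eq_splitQuadric_iff`** (`dim H^{2l+2}(ℰ)(l+1)_{(φᵐ),1} =
  dim H^{2l+2}(ℋ)(l+1)_{(φᵐ),1} ⟺ m` even).

HC is not touched.

## References

* [Stichtenoth2009] H. Stichtenoth, Algebraic Function Fields and Codes, 2nd ed. (2009), Thm. 5.1.15 (f).
* [Hirschfeld1998] J. W. P. Hirschfeld, Projective Geometries over Finite Fields (1998), §5.2 Thm. 5.2.6 (ii)–(iii).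
* [TateWoodsHole1965] J. Tate, Algebraic cycles and poles of zeta functions (1965), §3.
* [Tate1994] J. Tate, Conjectures on algebraic cycles in ℓ-adic cohomology, PSPM 55.1 (1994), §1, §2 Th. 2.9.
* [Kahn2020] B. Kahn, Zeta and L-Functions of Varieties and Motives (2020), §3.6 Remark 3.66; §6.14 Conj. 6.52, Th. 6.53.
* [Gottsche1993] L. Göttsche, Hilbert Schemes of Zero-Dimensional Subschemes of Smooth Varieties, LNM 1572 (1993),
  §1.2 Remark 1.2.2.
* [Milne1986ValuesZetaFunctionsFiniteFields] J. S. Milne, Values of zeta functions of varieties over finite fields,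
  Amer. J. Math. 108 (1986), §8.
* [Weil1949] A. Weil, Bull. AMS 55 (1949), p. 507.
* [MalleTesterman2011] G. Malle, D. Testerman, Linear Algebraic Groups and Finite Groups of Lie Type (2011), §2.1
  Def. 2.1 (unipotent elements; powers).
* Tree: `Motives/SplitQuadricPointCount` (g51-#8), `Motives/EllipticQuadricPointCount` (g51-#11),
  `Motives/EllipticQuadricConstantFieldExtensions` (g52-#6), `Motives/QuadricsFiniteFieldCohomology` (g52-#3),
  `Motives/PolynomialPointCountsBettiNumbers` (`maxGenEigenspace_ρTwist_eq_top_of_pointCount_eq_sum`),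
  `Motives/ZetaFunctionConstantFieldExtensionPoleOrder` (`hasPoleOfOrderAt_zetaSeriesPow`),
  `Kahn2003/RationalNumericalEquivalenceOfTate` (`HasPoleOfOrderAt`, `.unique`).

## Provenance

Lane `lit-hodgefound` (summit `HodgeConjecture`, Track 2 foundations library, Layer B: motives ∕ varieties over finite
fields), seat `lit-hodgefound-p29` (literature-prover, generation 52, row g52-#7).
-/

universe u v

open Polynomial Finset CategoryTheory AlgebraicGeometry
open Literature.NumberTheory.LFunctions.Dwork (countZeta countZeta_congr countZeta_pow_mul countZeta_sum countZeta_add)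
open Literature.AlgebraicGeometry.Kahn2003 (HasPoleOfOrderAt hasPoleOfOrderAt_of_mul_prod_pow_eq_one)

noncomputable section

namespace Literature.AlgebraicGeometry.Motives

/-! ### §0 Powers of a generalized-unipotent endomorphism -/

section LinearAlgebra

variable {R : Type*} {M : Type*} [CommRing R] [AddCommGroup M] [Module R M]

/-- **If every vector is a generalized fixed vector of `f`, then also of `fᵐ`**: `V_{(f),1} = V ⟹ V_{(fᵐ),1} = V`,
since `fᵐ − 1 = (1 + f + ⋯ + f^{m−1})·(f − 1)` with commuting factors, so `(fᵐ − 1)ⁿ = (Σ fⁱ)ⁿ (f − 1)ⁿ` kills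
whatever `(f − 1)ⁿ` kills — «powers of a unipotent element are unipotent» (the tree's `isNilpotent_pow_sub_one`,
`LinearAlgebra/MultiplicativeJordanDecomposition`, in generalized-eigenspace form). [cite: MalleTesterman2011, §2.1, Def. 2.1] -/
theorem maxGenEigenspace_pow_eq_top_of_eq_top {f : Module.End R M} (h : f.maxGenEigenspace 1 = ⊤) (m : ℕ) :
    (f ^ m).maxGenEigenspace 1 = ⊤ := by
  rw [eq_top_iff]
  rintro x -
  have hx : x ∈ f.maxGenEigenspace 1 := by rw [h]; exact Submodule.mem_top
  rw [Module.End.mem_maxGenEigenspace] at hx ⊢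
  obtain ⟨n, hn⟩ := hx
  refine ⟨n, ?_⟩
  rw [one_smul] at hn ⊢
  have hc : Commute (∑ i ∈ Finset.range m, f ^ i) (f - 1) :=
    Commute.sum_left _ _ _ fun i _ => ((Commute.refl f).pow_left i).sub_right (Commute.one_right _)
  rw [← geom_sum_mul f m, hc.mul_pow, Module.End.mul_apply, hn, map_zero]

/-- **If `f = 1` then `fᵐ = 1`**, in kernel form: `Ker(f − 1) = V ⟹ Ker(fᵐ − 1) = V` (the trivial unipotent).
[cite: MalleTesterman2011, §2.1, Def. 2.1] -/
theorem ker_pow_sub_one_eq_top_of_eq_top {f : Module.End R M} (h : LinearMap.ker (f - 1) = ⊤) (m : ℕ) :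
    LinearMap.ker (f ^ m - 1) = ⊤ := by
  rw [LinearMap.ker_eq_top, sub_eq_zero] at h ⊢
  rw [h, one_pow]

end LinearAlgebra

/-! ### §1 `Z(ℋ ⊗ 𝔽_{q^m}, T)` for every `m ≥ 1`; the comparison `ℰ` versus `ℋ` over `𝔽_{q^m}` -/

section EFree

open SmoothHypersurface (hypersurface)

variable {k : Type u} [Field k] [Finite k] (l : ℕ)

/-- `l + 2 ≤ 2l + 2 + 2` (any proof matches the tree's by proof irrelevance). [folklore] -/
private theorem leS (l : ℕ) : l + 2 ≤ 2 * l + 2 + 2 := by omega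

/-- `l + 1 ≤ 2l + 2 + 2`. [folklore] -/
private theorem leE (l : ℕ) : l + 1 ≤ 2 * l + 2 + 2 := by omega

/-- The middle coordinate `l + 1`. [folklore] -/
private theorem ltE₁ (l : ℕ) : l + 1 < 2 * l + 2 + 2 := by omega

/-- The middle coordinate `l + 2`. [folklore] -/
private theorem ltE₂ (l : ℕ) : l + 2 < 2 * l + 2 + 2 := by omega

section Split

variable (ε : Fin (l + 2) → kˣ)

/-- **`Z(ℋ ⊗ 𝔽_{q^m}, T) · ∏_{i=0}^{2l+2} (1 − (q^m)ⁱT) · (1 − (q^m)^{l+1}T) = 1`** for every `m ≥ 1`: over `𝔽_{q^m}`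
the inverse roots of the zeta function of the hyperbolic quadric are the `m`-th powers `q^{mi}` (`i ≤ 2l+2`), the
middle one `q^{m(l+1)}` TWICE (Dwork's `countZeta` of `#ℋ(𝔽_{q^{ms}}) = Σ q^{msi} + q^{ms(l+1)}`).
[cite: Stichtenoth2009, Theorem 5.1.15 (f)] [cite: Hirschfeld1998, §5.2 Thm. 5.2.6 (ii)] [cite: Weil1949, p. 507] -/
theorem zetaSeriesPow_splitQuadric_mul_prod {m : ℕ} (hm : 0 < m) :
    zetaSeriesPow
        (hypersurface (∑ i : Fin (l + 2), MvPolynomial.C (ε i : k) * MvPolynomial.X (Fin.castLE (leS l) i) *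
          MvPolynomial.X (Fin.rev (Fin.castLE (leS l) i)) : MvPolynomial (Fin (2 * l + 2 + 2)) k)) m *
      ((∏ i ∈ range (2 * l + 3), ((1 - C (((Nat.card k : ℚ) ^ m) ^ i) * X : ℚ[X]) : PowerSeries ℚ)) *
        ((1 - C (((Nat.card k : ℚ) ^ m) ^ (l + 1)) * X : ℚ[X]) : PowerSeries ℚ)) = 1 := by
  have hZ : zetaSeriesPow
        (hypersurface (∑ i : Fin (l + 2), MvPolynomial.C (ε i : k) * MvPolynomial.X (Fin.castLE (leS l) i) *
          MvPolynomial.X (Fin.rev (Fin.castLE (leS l) i)) : MvPolynomial (Fin (2 * l + 2 + 2)) k)) m =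
      (∏ i ∈ range (2 * l + 3), countZeta (fun s => (((Nat.card k : ℤ) ^ m) ^ i) ^ s)) *
        countZeta (fun s => (((Nat.card k : ℤ) ^ m) ^ (l + 1)) ^ s) := by
    rw [zetaSeriesPow_eq_countZeta, ← countZeta_sum, ← countZeta_add]
    refine countZeta_congr fun s hs => ?_
    rw [pointCount_splitQuadric l ε (Nat.mul_pos hm hs), Pi.add_apply, Finset.sum_apply, Nat.cast_add,
      Nat.cast_sum]
    congr 1
    · exact Finset.sum_congr rfl fun i _ => by rw [Nat.cast_pow, ← pow_mul, ← pow_mul]; ring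
    · rw [Nat.cast_pow, ← pow_mul, ← pow_mul]; ring
  have hc : ∀ a : ℤ, countZeta (fun s => a ^ s) * ((1 - C (a : ℚ) * X : ℚ[X]) : PowerSeries ℚ) = 1 :=
    fun a => countZeta_pow_mul a
  have hc₁ : ∀ i : ℕ, countZeta (fun s => (((Nat.card k : ℤ) ^ m) ^ i) ^ s) *
      ((1 - C (((Nat.card k : ℚ) ^ m) ^ i) * X : ℚ[X]) : PowerSeries ℚ) = 1 := by
    intro i
    have h := hc (((Nat.card k : ℤ) ^ m) ^ i)
    rw [Int.cast_pow, Int.cast_pow, Int.cast_natCast] at h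
    exact h
  rw [hZ, mul_mul_mul_comm, ← Finset.prod_mul_distrib, Finset.prod_eq_one fun i _ => hc₁ i, one_mul, hc₁ (l + 1)]

/-- **The pole orders of `Z(ℋ ⊗ 𝔽_{q^m}, T)`: EXACTLY `2` at `T = (q^m)^{−(l+1)}` and EXACTLY `1` at `(q^m)^{−r}`,
`r ≠ l+1` (`r ≤ 2l+2`), for every `m ≥ 1`** — both rulings of the hyperbolic quadric are rational over every `𝔽_{q^m}`
(Tate 1965 §3: the rank of the middle-dimensional cycles is `2`). [cite: TateWoodsHole1965, §3]
[cite: Kahn2020, §6.14 Conj. 6.52] [cite: Hirschfeld1998, §5.2 Thm. 5.2.6 (ii)] -/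
theorem hasPoleOfOrderAt_zetaSeriesPow_splitQuadric {m : ℕ} (hm : 0 < m) {r : ℕ} (hr : r ≤ 2 * l + 2) :
    HasPoleOfOrderAt (zetaSeriesPow
        (hypersurface (∑ i : Fin (l + 2), MvPolynomial.C (ε i : k) * MvPolynomial.X (Fin.castLE (leS l) i) *
          MvPolynomial.X (Fin.rev (Fin.castLE (leS l) i)) : MvPolynomial (Fin (2 * l + 2 + 2)) k)) m)
      ((((Nat.card k : ℚ) ^ m) ^ r)⁻¹) (if r = l + 1 then 2 else 1) := by
  have hZ := zetaSeriesPow_splitQuadric_mul_prod l ε hm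
  have hqm : 1 < Nat.card k ^ m := Nat.one_lt_pow hm.ne' Finite.one_lt_card
  -- the product as `∏ (1 − (q^m)ⁱT)^{cᵢ}`, `c_{l+1} = 2`
  have hprod : (∏ i ∈ Finset.range (2 * l + 3), ((1 - C (((Nat.card k : ℚ) ^ m) ^ i) * X : ℚ[X]) : PowerSeries ℚ)) *
      ((1 - C (((Nat.card k : ℚ) ^ m) ^ (l + 1)) * X : ℚ[X]) : PowerSeries ℚ) =
      ((∏ i ∈ Finset.range (2 * l + 3), (1 - C ((((Nat.card k ^ m : ℕ) : ℚ)) ^ i) * X) ^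
        (if i = l + 1 then 2 else 1) : ℚ[X]) : PowerSeries ℚ) := by
    have hpoly : (∏ i ∈ Finset.range (2 * l + 3), (1 - C ((((Nat.card k ^ m : ℕ) : ℚ)) ^ i) * X) ^
        (if i = l + 1 then 2 else 1) : ℚ[X]) =
        (∏ i ∈ Finset.range (2 * l + 3), (1 - C (((Nat.card k : ℚ) ^ m) ^ i) * X)) *
          (1 - C (((Nat.card k : ℚ) ^ m) ^ (l + 1)) * X) := by
      rw [Nat.cast_pow, Finset.prod_congr rfl (fun i _ => (by
          split_ifs with h
          · rw [h, pow_two]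
          · rw [pow_one, mul_one]) :
          ∀ i ∈ Finset.range (2 * l + 3), ((1 - C (((Nat.card k : ℚ) ^ m) ^ i) * X) ^ (if i = l + 1 then 2 else 1) :
            ℚ[X]) = (1 - C (((Nat.card k : ℚ) ^ m) ^ i) * X) *
              (if i = l + 1 then (1 - C (((Nat.card k : ℚ) ^ m) ^ (l + 1)) * X) else 1)),
        Finset.prod_mul_distrib, Finset.prod_ite_eq', if_pos (Finset.mem_range.mpr (by omega))]
    rw [hpoly, Polynomial.coe_mul]
    congr 1
    symm
    rw [← Polynomial.coeToPowerSeries.ringHom_apply, map_prod]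
    exact Finset.prod_congr rfl fun i _ => by rw [Polynomial.coeToPowerSeries.ringHom_apply]
  rw [hprod] at hZ
  have h := hasPoleOfOrderAt_of_mul_prod_pow_eq_one (Finset.range (2 * l + 3)) (fun i => i)
    (fun i => if i = l + 1 then 2 else 1) hqm r hZ
  simp only [Finset.filter_eq', Finset.mem_range, show r < 2 * l + 3 by omega, if_true,
    Finset.sum_singleton, Nat.cast_pow] at h
  exact h

/-- **The middle pole of `Z(ℋ ⊗ 𝔽_{q^m}, T)` at `(q^m)^{−(l+1)}` is DOUBLE for every `m ≥ 1`.** [cite: TateWoodsHole1965, §3]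
[cite: Kahn2020, §6.14 Conj. 6.52] -/
theorem hasPoleOfOrderAt_zetaSeriesPow_splitQuadric_middle {m : ℕ} (hm : 0 < m) :
    HasPoleOfOrderAt (zetaSeriesPow
        (hypersurface (∑ i : Fin (l + 2), MvPolynomial.C (ε i : k) * MvPolynomial.X (Fin.castLE (leS l) i) *
          MvPolynomial.X (Fin.rev (Fin.castLE (leS l) i)) : MvPolynomial (Fin (2 * l + 2 + 2)) k)) m)
      ((((Nat.card k : ℚ) ^ m) ^ (l + 1))⁻¹) 2 := by
  have h := hasPoleOfOrderAt_zetaSeriesPow_splitQuadric l ε hm (show l + 1 ≤ 2 * l + 2 by omega)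
  rwa [if_pos rfl] at h

/-- Off the middle the poles of `Z(ℋ ⊗ 𝔽_{q^m}, T)` are simple (`r ≤ 2l+2`, `r ≠ l+1`, every `m ≥ 1`).
[cite: TateWoodsHole1965, §3] [cite: Weil1949, p. 507] -/
theorem hasPoleOfOrderAt_zetaSeriesPow_splitQuadric_of_ne {m : ℕ} (hm : 0 < m) {r : ℕ} (hr : r ≤ 2 * l + 2)
    (hne : r ≠ l + 1) :
    HasPoleOfOrderAt (zetaSeriesPow
        (hypersurface (∑ i : Fin (l + 2), MvPolynomial.C (ε i : k) * MvPolynomial.X (Fin.castLE (leS l) i) *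
          MvPolynomial.X (Fin.rev (Fin.castLE (leS l) i)) : MvPolynomial (Fin (2 * l + 2 + 2)) k)) m)
      ((((Nat.card k : ℚ) ^ m) ^ r)⁻¹) 1 := by
  have h := hasPoleOfOrderAt_zetaSeriesPow_splitQuadric l ε hm hr
  rwa [if_neg hne] at h

end Split

section Compare

variable {ε : k} (ε' : Fin (l + 2) → kˣ)

/-- **`#ℰ(𝔽_{q^m}) = #ℋ(𝔽_{q^m})` for `m` even**: over an even-degree extension the elliptic and the hyperbolic
quadric of `ℙ^{2l+3}` have the same number of points (`ε` becomes a square). [cite: Hirschfeld1998, §5.2 Thm. 5.2.6 (ii), (iii)] -/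
theorem pointCount_ellipticQuadric_eq_splitQuadric_of_even (hε : ¬IsSquare ε) {m : ℕ} (hm : 0 < m)
    (heven : Even m) :
    pointCount
        (hypersurface ((∑ i : Fin (l + 1), MvPolynomial.X (Fin.castLE (leE l) i) *
          MvPolynomial.X (Fin.rev (Fin.castLE (leE l) i))) + MvPolynomial.X (Fin.mk (l + 1) (ltE₁ l)) ^ 2 -
          MvPolynomial.C ε * MvPolynomial.X (Fin.mk (l + 2) (ltE₂ l)) ^ 2 : MvPolynomial (Fin (2 * l + 2 + 2)) k)) m =
      pointCount
        (hypersurface (∑ i : Fin (l + 2), MvPolynomial.C (ε' i : k) * MvPolynomial.X (Fin.castLE (leS l) i) *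
          MvPolynomial.X (Fin.rev (Fin.castLE (leS l) i)) : MvPolynomial (Fin (2 * l + 2 + 2)) k)) m := by
  rw [pointCount_ellipticQuadric_of_even l hε hm heven, pointCount_splitQuadric l ε' hm]

/-- **`#ℰ(𝔽_{q^m}) + 2q^{m(l+1)} = #ℋ(𝔽_{q^m})` for `m` odd**: Hirschfeld's `ψ₊ − ψ₋ = 2q^{s−1}` with `s = l+2`,
`q ↦ q^m`. [cite: Hirschfeld1998, §5.2 Thm. 5.2.6 (ii), (iii)] -/
theorem pointCount_ellipticQuadric_add_eq_splitQuadric_of_odd (hε : ¬IsSquare ε) {m : ℕ} (hm : 0 < m)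
    (hodd : Odd m) :
    pointCount
        (hypersurface ((∑ i : Fin (l + 1), MvPolynomial.X (Fin.castLE (leE l) i) *
          MvPolynomial.X (Fin.rev (Fin.castLE (leE l) i))) + MvPolynomial.X (Fin.mk (l + 1) (ltE₁ l)) ^ 2 -
          MvPolynomial.C ε * MvPolynomial.X (Fin.mk (l + 2) (ltE₂ l)) ^ 2 : MvPolynomial (Fin (2 * l + 2 + 2)) k)) m + 2 * Nat.card k ^ (m * (l + 1)) =
      pointCount
        (hypersurface (∑ i : Fin (l + 2), MvPolynomial.C (ε' i : k) * MvPolynomial.X (Fin.castLE (leS l) i) *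
          MvPolynomial.X (Fin.rev (Fin.castLE (leS l) i)) : MvPolynomial (Fin (2 * l + 2 + 2)) k)) m := by
  rw [pointCount_splitQuadric l ε' hm, ← pointCount_ellipticQuadric_add_of_odd l hε hm hodd]
  omega

/-- **`#ℰ(𝔽_{q^m}) < #ℋ(𝔽_{q^m})` for `m` odd.** [cite: Hirschfeld1998, §5.2 Thm. 5.2.6 (ii), (iii)] -/
theorem pointCount_ellipticQuadric_lt_splitQuadric_of_odd (hε : ¬IsSquare ε) {m : ℕ} (hm : 0 < m)
    (hodd : Odd m) :
    pointCount
        (hypersurface ((∑ i : Fin (l + 1), MvPolynomial.X (Fin.castLE (leE l) i) *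
          MvPolynomial.X (Fin.rev (Fin.castLE (leE l) i))) + MvPolynomial.X (Fin.mk (l + 1) (ltE₁ l)) ^ 2 -
          MvPolynomial.C ε * MvPolynomial.X (Fin.mk (l + 2) (ltE₂ l)) ^ 2 : MvPolynomial (Fin (2 * l + 2 + 2)) k)) m <
      pointCount
        (hypersurface (∑ i : Fin (l + 2), MvPolynomial.C (ε' i : k) * MvPolynomial.X (Fin.castLE (leS l) i) *
          MvPolynomial.X (Fin.rev (Fin.castLE (leS l) i)) : MvPolynomial (Fin (2 * l + 2 + 2)) k)) m := by
  rw [← pointCount_ellipticQuadric_add_eq_splitQuadric_of_odd l ε' hε hm hodd]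
  exact Nat.lt_add_of_pos_right (Nat.mul_pos two_pos (pow_pos Nat.card_pos _))

/-- **`#ℰ(𝔽_{q^m}) = #ℋ(𝔽_{q^m}) ⟺ m` is even** (`m ≥ 1`). [cite: Hirschfeld1998, §5.2 Thm. 5.2.6 (ii), (iii)] -/
theorem pointCount_ellipticQuadric_eq_splitQuadric_iff (hε : ¬IsSquare ε) {m : ℕ} (hm : 0 < m) :
    pointCount
        (hypersurface ((∑ i : Fin (l + 1), MvPolynomial.X (Fin.castLE (leE l) i) *
          MvPolynomial.X (Fin.rev (Fin.castLE (leE l) i))) + MvPolynomial.X (Fin.mk (l + 1) (ltE₁ l)) ^ 2 -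
          MvPolynomial.C ε * MvPolynomial.X (Fin.mk (l + 2) (ltE₂ l)) ^ 2 : MvPolynomial (Fin (2 * l + 2 + 2)) k)) m =
      pointCount
        (hypersurface (∑ i : Fin (l + 2), MvPolynomial.C (ε' i : k) * MvPolynomial.X (Fin.castLE (leS l) i) *
          MvPolynomial.X (Fin.rev (Fin.castLE (leS l) i)) : MvPolynomial (Fin (2 * l + 2 + 2)) k)) m ↔ Even m := by
  refine ⟨fun h => ?_, pointCount_ellipticQuadric_eq_splitQuadric_of_even l ε' hε hm⟩
  by_contra hodd
  exact (pointCount_ellipticQuadric_lt_splitQuadric_of_odd l ε' hε hm (Nat.not_even_iff_odd.mp hodd)).ne h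

/-- **`Z(ℰ ⊗ 𝔽_{q^m}, T) = Z(ℋ ⊗ 𝔽_{q^m}, T)` for every even `m`** (the tree's
`zetaSeriesPow_ellipticQuadric_two_eq_splitQuadric` is `m = 2`): the two quadrics have the same point counts over
every `𝔽_{q^{ms}}`. [cite: Hirschfeld1998, §5.2 Thm. 5.2.6 (ii), (iii)] [cite: Stichtenoth2009, Theorem 5.1.15 (f)] -/
theorem zetaSeriesPow_ellipticQuadric_eq_splitQuadric_of_even (hε : ¬IsSquare ε) {m : ℕ} (hm : 0 < m)
    (heven : Even m) :
    zetaSeriesPow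
        (hypersurface ((∑ i : Fin (l + 1), MvPolynomial.X (Fin.castLE (leE l) i) *
          MvPolynomial.X (Fin.rev (Fin.castLE (leE l) i))) + MvPolynomial.X (Fin.mk (l + 1) (ltE₁ l)) ^ 2 -
          MvPolynomial.C ε * MvPolynomial.X (Fin.mk (l + 2) (ltE₂ l)) ^ 2 : MvPolynomial (Fin (2 * l + 2 + 2)) k)) m =
      zetaSeriesPow
        (hypersurface (∑ i : Fin (l + 2), MvPolynomial.C (ε' i : k) * MvPolynomial.X (Fin.castLE (leS l) i) *
          MvPolynomial.X (Fin.rev (Fin.castLE (leS l) i)) : MvPolynomial (Fin (2 * l + 2 + 2)) k)) m := by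
  rw [zetaSeriesPow_eq_countZeta, zetaSeriesPow_eq_countZeta]
  refine countZeta_congr fun s hs => ?_
  rw [pointCount_ellipticQuadric_eq_splitQuadric_of_even l ε' hε (Nat.mul_pos hm hs) (heven.mul_right s)]

/-- **`Z(ℰ ⊗ 𝔽_{q^m}, T) ≠ Z(ℋ ⊗ 𝔽_{q^m}, T)` for `m` odd**: the middle pole of the first is simple, of the second
double (over an odd-degree extension the elliptic quadric stays elliptic). [cite: TateWoodsHole1965, §3]
[cite: Hirschfeld1998, §5.2 Thm. 5.2.6 (ii), (iii)] -/
theorem zetaSeriesPow_ellipticQuadric_ne_splitQuadric_of_odd (hε : ¬IsSquare ε) {m : ℕ} (hodd : Odd m) :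
    zetaSeriesPow
        (hypersurface ((∑ i : Fin (l + 1), MvPolynomial.X (Fin.castLE (leE l) i) *
          MvPolynomial.X (Fin.rev (Fin.castLE (leE l) i))) + MvPolynomial.X (Fin.mk (l + 1) (ltE₁ l)) ^ 2 -
          MvPolynomial.C ε * MvPolynomial.X (Fin.mk (l + 2) (ltE₂ l)) ^ 2 : MvPolynomial (Fin (2 * l + 2 + 2)) k)) m ≠
      zetaSeriesPow
        (hypersurface (∑ i : Fin (l + 2), MvPolynomial.C (ε' i : k) * MvPolynomial.X (Fin.castLE (leS l) i) *
          MvPolynomial.X (Fin.rev (Fin.castLE (leS l) i)) : MvPolynomial (Fin (2 * l + 2 + 2)) k)) m := by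
  intro h
  have h1 := hasPoleOfOrderAt_zetaSeriesPow_ellipticQuadric_middle_of_odd l hε hodd
  rw [h] at h1
  exact absurd (h1.unique (hasPoleOfOrderAt_zetaSeriesPow_splitQuadric_middle l ε' hodd.pos)) (by decide)

/-- **`Z(ℰ ⊗ 𝔽_{q^m}, T) = Z(ℋ ⊗ 𝔽_{q^m}, T) ⟺ m` is even** (`m ≥ 1`): the elliptic and the hyperbolic quadric of
`ℙ^{2l+3}` become "zeta-equivalent" exactly over the even-degree extensions of `𝔽_q`.
[cite: Hirschfeld1998, §5.2 Thm. 5.2.6 (ii), (iii)] [cite: TateWoodsHole1965, §3] -/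
theorem zetaSeriesPow_ellipticQuadric_eq_splitQuadric_iff (hε : ¬IsSquare ε) {m : ℕ} (hm : 0 < m) :
    zetaSeriesPow
        (hypersurface ((∑ i : Fin (l + 1), MvPolynomial.X (Fin.castLE (leE l) i) *
          MvPolynomial.X (Fin.rev (Fin.castLE (leE l) i))) + MvPolynomial.X (Fin.mk (l + 1) (ltE₁ l)) ^ 2 -
          MvPolynomial.C ε * MvPolynomial.X (Fin.mk (l + 2) (ltE₂ l)) ^ 2 : MvPolynomial (Fin (2 * l + 2 + 2)) k)) m =
      zetaSeriesPow
        (hypersurface (∑ i : Fin (l + 2), MvPolynomial.C (ε' i : k) * MvPolynomial.X (Fin.castLE (leS l) i) *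
          MvPolynomial.X (Fin.rev (Fin.castLE (leS l) i)) : MvPolynomial (Fin (2 * l + 2 + 2)) k)) m ↔ Even m := by
  refine ⟨fun h => ?_, zetaSeriesPow_ellipticQuadric_eq_splitQuadric_of_even l ε' hε hm⟩
  by_contra hodd
  exact zetaSeriesPow_ellipticQuadric_ne_splitQuadric_of_odd l ε' hε (Nat.not_even_iff_odd.mp hodd) h

end Compare

end EFree

/-! ### §2 In cohomology: polynomial point counts make `H^{2r}(X)(r)` generalized-unipotent under every `φ_r(Fᵐ)` -/

namespace GaloisWeilCohomology

open SmoothHypersurface (hypersurface)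

variable {k : Type u} [Field k] [Finite k] {K : Type v} [Field K] [CharZero K]
  {χ : Field.absoluteGaloisGroup k →* Kˣ} (E : GaloisWeilCohomology k K χ)

section PolynomialCount

variable {d : ℕ} {X : SchemeOver k}

/-- **`H^{2r}(X)(r) = H^{2r}(X)(r)_{(φ_r(Fᵐ)),1}` for EVERY `m` under polynomial point counts**: the twisted Frobenius
of `𝔽_{q^m}`, `φ_r(Fᵐ) = φ_rᵐ`, has the single generalized eigenvalue `1` on `H^{2r}(X)` (the tree's `m = 1` case
`maxGenEigenspace_ρTwist_eq_top_of_pointCount_eq_sum` and §0). [cite: Gottsche1993, §1.2 Remark 1.2.2 (proof) p. 7]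
[cite: Milne1986ValuesZetaFunctionsFiniteFields, §8 p. 345] [cite: Tate1994, §2 Th. 2.9] -/
theorem maxGenEigenspace_ρTwist_pow_eq_top_of_pointCount_eq_sum (hE : E.HasLefschetzTraceFormula)
    (hχ : ((χ (arithFrob k) : Kˣ) : K) = Nat.card k) (hX : IsSmoothProjective d X)
    (hRH : E.WeilRiemannHypothesisFor X d) {c : ℕ → ℚ} {N : ℕ}
    (hc : ∀ m : ℕ, 0 < m →
      (pointCount X m : ℚ) = ∑ r ∈ Finset.range (N + 1), c r * (Nat.card k : ℚ) ^ (r * m))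
    (r m : ℕ) :
    Module.End.maxGenEigenspace (E.ρTwist X (2 * r) r (geomFrob k ^ m)) 1 = ⊤ := by
  rw [map_pow]
  exact maxGenEigenspace_pow_eq_top_of_eq_top (E.maxGenEigenspace_ρTwist_eq_top_of_pointCount_eq_sum hE hχ hX hRH hc r) m

/-- **`dim H^{2r}(X)(r)_{(φ_r(Fᵐ)),1} = b_{2r}(X)` for every `m`** under polynomial point counts.
[cite: Gottsche1993, §1.2 Remark 1.2.2 (proof) p. 7] [cite: Tate1994, §2 Th. 2.9] -/
theorem finrank_maxGenEigenspace_ρTwist_pow_of_pointCount_eq_sum (hE : E.HasLefschetzTraceFormula)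
    (hχ : ((χ (arithFrob k) : Kˣ) : K) = Nat.card k) (hX : IsSmoothProjective d X)
    (hRH : E.WeilRiemannHypothesisFor X d) {c : ℕ → ℚ} {N : ℕ}
    (hc : ∀ m : ℕ, 0 < m →
      (pointCount X m : ℚ) = ∑ r ∈ Finset.range (N + 1), c r * (Nat.card k : ℚ) ^ (r * m))
    (r m : ℕ) :
    Module.finrank K (Module.End.maxGenEigenspace (E.ρTwist X (2 * r) r (geomFrob k ^ m)) 1) =
      Module.finrank K (E.obj X (2 * r)) := by
  rw [E.maxGenEigenspace_ρTwist_pow_eq_top_of_pointCount_eq_sum hE hχ hX hRH hc r m, finrank_top]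

/-- **`ord_{T=(q^m)^{−r}} Z(X ⊗ 𝔽_{q^m}, T) = b_{2r}(X)` for every `m ≥ 1`, `r ≤ d`, under polynomial point counts**:
over every constant field extension the pole order at `(q^m)^{−r}` is the full even Betti number (the tree's
`hasPoleOfOrderAt_zetaSeriesPow` = `dim H^{2r}(X)(r)_{(φ_r(Fᵐ)),1}`). [cite: Kahn2020, §6.14 Conj. 6.52]
[cite: TateWoodsHole1965, §3] [cite: Gottsche1993, §1.2 Remark 1.2.2] -/
theorem hasPoleOfOrderAt_zetaSeriesPow_of_pointCount_eq_sum (hE : E.HasLefschetzTraceFormula)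
    (hχ : ((χ (arithFrob k) : Kˣ) : K) = Nat.card k) (hX : IsSmoothProjective d X)
    (hRH : E.WeilRiemannHypothesisFor X d) {c : ℕ → ℚ} {N : ℕ}
    (hc : ∀ m : ℕ, 0 < m →
      (pointCount X m : ℚ) = ∑ r ∈ Finset.range (N + 1), c r * (Nat.card k : ℚ) ^ (r * m))
    {r : ℕ} (hr : r ≤ d) {m : ℕ} (hm : 0 < m) :
    HasPoleOfOrderAt (zetaSeriesPow X m) ((((Nat.card k : ℚ) ^ m) ^ r)⁻¹) (Module.finrank K (E.obj X (2 * r))) := by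
  have h := E.hasPoleOfOrderAt_zetaSeriesPow hE hχ hX hRH hr hm
  rwa [E.finrank_maxGenEigenspace_ρTwist_pow_of_pointCount_eq_sum hE hχ hX hRH hc r m] at h

/-- **`φ_r` semisimple at `1` ⟹ `φ_r(Fᵐ) = 1` on `H^{2r}(X)(r)` for every `m`** under polynomial point counts
(Kahn's `Sʳ`, Milne's `SS(X, r)`: then `φ_r = 1`, hence all its powers).
[cite: Kahn2020, §6.14 Th. 6.53] [cite: Milne1986ValuesZetaFunctionsFiniteFields, §8 Prop. 8.2] -/
theorem ker_ρTwist_pow_sub_one_eq_top_of_pointCount_eq_sum (hE : E.HasLefschetzTraceFormula)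
    (hχ : ((χ (arithFrob k) : Kˣ) : K) = Nat.card k) (hX : IsSmoothProjective d X)
    (hRH : E.WeilRiemannHypothesisFor X d) {c : ℕ → ℚ} {N : ℕ}
    (hc : ∀ m : ℕ, 0 < m →
      (pointCount X m : ℚ) = ∑ r ∈ Finset.range (N + 1), c r * (Nat.card k : ℚ) ^ (r * m))
    (r : ℕ)
    (hS : LinearMap.ker (E.ρTwist X (2 * r) r (geomFrob k) - 1) ⊓
      LinearMap.range (E.ρTwist X (2 * r) r (geomFrob k) - 1) = ⊥) (m : ℕ) :
    LinearMap.ker (E.ρTwist X (2 * r) r (geomFrob k ^ m) - 1) = ⊤ := by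
  rw [map_pow]
  exact ker_pow_sub_one_eq_top_of_eq_top (E.ker_ρTwist_sub_one_eq_top_of_pointCount_eq_sum hE hχ hX hRH hc r hS) m

end PolynomialCount

/-! ### §3 The hyperbolic quadric in cohomology over `𝔽_{q^m}`; comparison with `ℰ` -/

section SplitQuadric

variable (l : ℕ) (ε : Fin (l + 2) → kˣ)

/-- `l + 2 ≤ 2l + 2 + 2` (any proof matches the tree's by proof irrelevance). [folklore] -/
private theorem leS' (l : ℕ) : l + 2 ≤ 2 * l + 2 + 2 := by omega

/-- **`H^{2r}(ℋ)(r) = H^{2r}(ℋ)(r)_{(φ_r(Fᵐ)),1}` for every `r` and every `m`.** [cite: Gottsche1993, §1.2 Remark 1.2.2]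
[cite: Tate1994, §2 Th. 2.9] [cite: Hirschfeld1998, §5.2 Thm. 5.2.6 (ii)] -/
theorem maxGenEigenspace_ρTwist_pow_splitQuadric_eq_top (hE : E.HasLefschetzTraceFormula)
    (hχ : ((χ (arithFrob k) : Kˣ) : K) = Nat.card k)
    (hRH : E.WeilRiemannHypothesisFor
      (hypersurface (∑ i : Fin (l + 2), MvPolynomial.C (ε i : k) * MvPolynomial.X (Fin.castLE (leS' l) i) *
          MvPolynomial.X (Fin.rev (Fin.castLE (leS' l) i)) : MvPolynomial (Fin (2 * l + 2 + 2)) k)) (2 * l + 2)) (r m : ℕ) :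
    Module.End.maxGenEigenspace (E.ρTwist
        (hypersurface (∑ i : Fin (l + 2), MvPolynomial.C (ε i : k) * MvPolynomial.X (Fin.castLE (leS' l) i) *
          MvPolynomial.X (Fin.rev (Fin.castLE (leS' l) i)) : MvPolynomial (Fin (2 * l + 2 + 2)) k)) (2 * r) r (geomFrob k ^ m)) 1 = ⊤ :=
  E.maxGenEigenspace_ρTwist_pow_eq_top_of_pointCount_eq_sum hE hχ (isSmoothProjective_splitQuadric l ε) hRH
    (fun _ hm => pointCount_splitQuadric_cast l ε hm) r m

/-- **`dim H^{2l+2}(ℋ)(l+1)_{(φ_{l+1}(Fᵐ)),1} = 2` for EVERY `m`** — the order of the middle pole of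
`Z(ℋ ⊗ 𝔽_{q^m}, T)` (§1) never drops. [cite: TateWoodsHole1965, §3] [cite: Kahn2020, §6.14 Conj. 6.52] -/
theorem finrank_maxGenEigenspace_ρTwist_pow_splitQuadric_middle (hE : E.HasLefschetzTraceFormula)
    (hχ : ((χ (arithFrob k) : Kˣ) : K) = Nat.card k)
    (hRH : E.WeilRiemannHypothesisFor
      (hypersurface (∑ i : Fin (l + 2), MvPolynomial.C (ε i : k) * MvPolynomial.X (Fin.castLE (leS' l) i) *
          MvPolynomial.X (Fin.rev (Fin.castLE (leS' l) i)) : MvPolynomial (Fin (2 * l + 2 + 2)) k)) (2 * l + 2)) (m : ℕ) :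
    Module.finrank K (Module.End.maxGenEigenspace (E.ρTwist
        (hypersurface (∑ i : Fin (l + 2), MvPolynomial.C (ε i : k) * MvPolynomial.X (Fin.castLE (leS' l) i) *
          MvPolynomial.X (Fin.rev (Fin.castLE (leS' l) i)) : MvPolynomial (Fin (2 * l + 2 + 2)) k)) (2 * (l + 1)) (l + 1 : ℕ) (geomFrob k ^ m)) 1) = 2 := by
  rw [E.maxGenEigenspace_ρTwist_pow_splitQuadric_eq_top l ε hE hχ hRH (l + 1) m, finrank_top,
    E.finrank_splitQuadric_middle l ε hE hχ hRH]

/-- Off the middle: `dim H^{2r}(ℋ)(r)_{(φ_r(Fᵐ)),1} = 1` (`r ≤ 2l+2`, `r ≠ l+1`, every `m`). [cite: Weil1949, p. 507]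
[cite: TateWoodsHole1965, §3] -/
theorem finrank_maxGenEigenspace_ρTwist_pow_splitQuadric_of_ne (hE : E.HasLefschetzTraceFormula)
    (hχ : ((χ (arithFrob k) : Kˣ) : K) = Nat.card k)
    (hRH : E.WeilRiemannHypothesisFor
      (hypersurface (∑ i : Fin (l + 2), MvPolynomial.C (ε i : k) * MvPolynomial.X (Fin.castLE (leS' l) i) *
          MvPolynomial.X (Fin.rev (Fin.castLE (leS' l) i)) : MvPolynomial (Fin (2 * l + 2 + 2)) k)) (2 * l + 2)) {r : ℕ} (hr : r ≤ 2 * l + 2) (hne : r ≠ l + 1) (m : ℕ) :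
    Module.finrank K (Module.End.maxGenEigenspace (E.ρTwist
        (hypersurface (∑ i : Fin (l + 2), MvPolynomial.C (ε i : k) * MvPolynomial.X (Fin.castLE (leS' l) i) *
          MvPolynomial.X (Fin.rev (Fin.castLE (leS' l) i)) : MvPolynomial (Fin (2 * l + 2 + 2)) k)) (2 * r) r (geomFrob k ^ m)) 1) = 1 := by
  rw [E.maxGenEigenspace_ρTwist_pow_splitQuadric_eq_top l ε hE hχ hRH r m, finrank_top,
    E.finrank_splitQuadric_two_mul_of_ne l ε hE hχ hRH hr hne]

/-- **`φ_r` semisimple at `1` on `H^{2r}(ℋ)` ⟹ `φ_r(Fᵐ) = 1` there for every `m`** (every class of `H^{2r}(ℋ)(r)` is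
fixed by the Frobenius of every `𝔽_{q^m}`). [cite: Kahn2020, §6.14 Th. 6.53] [cite: Milne1986ValuesZetaFunctionsFiniteFields, §8 Prop. 8.2] -/
theorem ker_ρTwist_pow_sub_one_splitQuadric_eq_top_of_semisimple (hE : E.HasLefschetzTraceFormula)
    (hχ : ((χ (arithFrob k) : Kˣ) : K) = Nat.card k)
    (hRH : E.WeilRiemannHypothesisFor
      (hypersurface (∑ i : Fin (l + 2), MvPolynomial.C (ε i : k) * MvPolynomial.X (Fin.castLE (leS' l) i) *
          MvPolynomial.X (Fin.rev (Fin.castLE (leS' l) i)) : MvPolynomial (Fin (2 * l + 2 + 2)) k)) (2 * l + 2)) (r : ℕ)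
    (hS : LinearMap.ker (E.ρTwist
        (hypersurface (∑ i : Fin (l + 2), MvPolynomial.C (ε i : k) * MvPolynomial.X (Fin.castLE (leS' l) i) *
          MvPolynomial.X (Fin.rev (Fin.castLE (leS' l) i)) : MvPolynomial (Fin (2 * l + 2 + 2)) k)) (2 * r) r (geomFrob k) - 1) ⊓
      LinearMap.range (E.ρTwist
        (hypersurface (∑ i : Fin (l + 2), MvPolynomial.C (ε i : k) * MvPolynomial.X (Fin.castLE (leS' l) i) *
          MvPolynomial.X (Fin.rev (Fin.castLE (leS' l) i)) : MvPolynomial (Fin (2 * l + 2 + 2)) k)) (2 * r) r (geomFrob k) - 1) = ⊥) (m : ℕ) :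
    LinearMap.ker (E.ρTwist
        (hypersurface (∑ i : Fin (l + 2), MvPolynomial.C (ε i : k) * MvPolynomial.X (Fin.castLE (leS' l) i) *
          MvPolynomial.X (Fin.rev (Fin.castLE (leS' l) i)) : MvPolynomial (Fin (2 * l + 2 + 2)) k)) (2 * r) r (geomFrob k ^ m) - 1) = ⊤ :=
  E.ker_ρTwist_pow_sub_one_eq_top_of_pointCount_eq_sum hE hχ (isSmoothProjective_splitQuadric l ε) hRH
    (fun _ hm => pointCount_splitQuadric_cast l ε hm) r hS m

end SplitQuadric

section Compare

variable (l : ℕ) {ε : k} (ε' : Fin (l + 2) → kˣ)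

/-- `l + 2 ≤ 2l + 2 + 2`. [folklore] -/
private theorem leS'' (l : ℕ) : l + 2 ≤ 2 * l + 2 + 2 := by omega

/-- `l + 1 ≤ 2l + 2 + 2`. [folklore] -/
private theorem leE' (l : ℕ) : l + 1 ≤ 2 * l + 2 + 2 := by omega

/-- The middle coordinate `l + 1`. [folklore] -/
private theorem ltE₁' (l : ℕ) : l + 1 < 2 * l + 2 + 2 := by omega

/-- The middle coordinate `l + 2`. [folklore] -/
private theorem ltE₂' (l : ℕ) : l + 2 < 2 * l + 2 + 2 := by omega

/-- **`dim H^{2l+2}(ℰ)(l+1)_{(φᵐ),1} = dim H^{2l+2}(ℋ)(l+1)_{(φᵐ),1} ⟺ m` is even** (`m ≥ 1`): in cohomology the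
elliptic quadric catches up with the hyperbolic one exactly over the even-degree extensions (`2 = 2` versus `1 ≠ 2`).
[cite: TateWoodsHole1965, §3] [cite: Kahn2020, §3.6 Remark 3.66 and §6.14 Conj. 6.52] -/
theorem finrank_maxGenEigenspace_ρTwist_pow_middle_ellipticQuadric_eq_splitQuadric_iff (hE : E.HasLefschetzTraceFormula)
    (hχ : ((χ (arithFrob k) : Kˣ) : K) = Nat.card k)
    (hε : ¬IsSquare ε)
    (hRH : E.WeilRiemannHypothesisFor
      (hypersurface ((∑ i : Fin (l + 1), MvPolynomial.X (Fin.castLE (leE' l) i) *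
          MvPolynomial.X (Fin.rev (Fin.castLE (leE' l) i))) + MvPolynomial.X (Fin.mk (l + 1) (ltE₁' l)) ^ 2 -
          MvPolynomial.C ε * MvPolynomial.X (Fin.mk (l + 2) (ltE₂' l)) ^ 2 : MvPolynomial (Fin (2 * l + 2 + 2)) k)) (2 * l + 2))
    (hRH' : E.WeilRiemannHypothesisFor
      (hypersurface (∑ i : Fin (l + 2), MvPolynomial.C (ε' i : k) * MvPolynomial.X (Fin.castLE (leS'' l) i) *
          MvPolynomial.X (Fin.rev (Fin.castLE (leS'' l) i)) : MvPolynomial (Fin (2 * l + 2 + 2)) k)) (2 * l + 2)) {m : ℕ} (hm : 0 < m) :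
    Module.finrank K (Module.End.maxGenEigenspace (E.ρTwist
        (hypersurface ((∑ i : Fin (l + 1), MvPolynomial.X (Fin.castLE (leE' l) i) *
          MvPolynomial.X (Fin.rev (Fin.castLE (leE' l) i))) + MvPolynomial.X (Fin.mk (l + 1) (ltE₁' l)) ^ 2 -
          MvPolynomial.C ε * MvPolynomial.X (Fin.mk (l + 2) (ltE₂' l)) ^ 2 : MvPolynomial (Fin (2 * l + 2 + 2)) k)) (2 * (l + 1)) (l + 1 : ℕ) (geomFrob k ^ m)) 1) =
      Module.finrank K (Module.End.maxGenEigenspace (E.ρTwist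
        (hypersurface (∑ i : Fin (l + 2), MvPolynomial.C (ε' i : k) * MvPolynomial.X (Fin.castLE (leS'' l) i) *
          MvPolynomial.X (Fin.rev (Fin.castLE (leS'' l) i)) : MvPolynomial (Fin (2 * l + 2 + 2)) k)) (2 * (l + 1)) (l + 1 : ℕ) (geomFrob k ^ m)) 1) ↔ Even m := by
  rw [E.finrank_maxGenEigenspace_ρTwist_pow_ellipticQuadric_middle l hE hχ hε hRH hm,
    E.finrank_maxGenEigenspace_ρTwist_pow_splitQuadric_middle l ε' hE hχ hRH' m]
  constructor
  · intro h
    by_contra hodd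
    rw [if_neg hodd] at h
    exact absurd h (by decide)
  · intro h
    rw [if_pos h]

end Compare

end GaloisWeilCohomology

end Literature.AlgebraicGeometry.Motives

end
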